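import Summits.QuantumFields.YangMills.Theorems.BalabanUVNodesPortS1G3CTwinObjects
import Summits.QuantumFields.YangMills.Theorems.BalabanUVNodesPortS1TwinIdxEquiv
import Summits.QuantumFields.YangMills.Theorems.BalabanUVNodesPortS1G3CWalks
import Literature.MathematicalPhysics.QuantumFieldTheory.Balaban1983to89.TreeLengthTorusGeometry

/-!
# NODE O port PT-A, offer (ζ) for `stub_G3C` of 27930 — THE CENTRED LIFT OF THE BLOCKS `□̃` AND OF THE WALK LOCALIZATIONS (geometry for the off-wrap bridge `g3cWZ ↔ g3cW`)

Cell `ym-nodeO-ideate`, porter seat `ymgap-nodeO-port-PTA-1` (gen 8), on ★★★ director-ym №573 (2); `--supports stmt-QuantumFields-27930` (helper, P0-free).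
[I] = [Balaban1987RG1], [B9] = [Balaban1985BackgroundPropagators].

* §1 `tblock_proj`, `tcollar_image_proj`, ★ `g3cBlk_eq_image_proj` — the torus block `□̃ = tcollar (tblock q)` is the projection of the integer block `g3cBlkZ q̂` of ANY representative `q̂`.
* §2 ★ `valMinAbs_proj_of_mem_g3cBlkZ` — OFF the centred wrap class, on a block `□̃ ⊆ X`, the centred lift inverts the projection (`ι ∘ proj = id` on `g3cBlkZ (ι q)`: no coordinate of the `5`-block
  crosses the antipodal seam, by ✓`valMinAbs_add_one_of_ne_half` walked `±2` steps from the centre); ★ `intCubes_g3cBlk` (`X̂_K(□̃_q) = g3cBlkZ (ι q)`), `g3cBlk_subset_of_g3cBlkZ_subset`,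
  `subset_of_intCubes_subset`.
* §3 the lifted walk `g3cLiftWalk` and ★ `g3cWalkLocZ_lift_iff` — `X̂(ι q₀, ŵ) = X̂_K(X) ↔ X(q₀, w) = X`.

HONEST FRAMING.  Index geometry only; NOTHING of Bałaban's estimates asserted, ported or discharged; `stub_G3C` OPEN; 27930 OPEN · no claim; NODE O 0∕1; COUNT 8∕28 · K 1∕4 UNMOVED; finite `𝕋⁴_{L^K}`
at fixed ε — NOT continuum ∕ OS ∕ Clay; **the Yang–Mills mass gap is NOT proved by any of this.**  No `sorry`, no `instance`, no `notation`; standard axioms.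
-/

noncomputable section

open scoped BigOperators
open Finset

namespace Summit.QuantumFields.YangMills.Theorems.BalabanUVNodesPortS1

open Summit.QuantumFields.YangMills.Theorems.K0RecordFormatNames
open Literature.MathematicalPhysics.QuantumFieldTheory.Balaban1983to89
open Literature.MathematicalPhysics.QuantumFieldTheory.Balaban1983to89.Node00
open Literature.MathematicalPhysics.QuantumFieldTheory.Balaban1983to89.T4Continuum (T4Family)
open Literature.MathematicalPhysics.QuantumFieldTheory.Balaban1983to89.TreeLengthTorus (TPt IsTDom proj natLift proj_natLift)
open Literature.MathematicalPhysics.QuantumFieldTheory.Balaban1983to89.TreeLengthTorusTransfer (tblock tcollar)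
open Literature.MathematicalPhysics.QuantumFieldTheory.Balaban1983to89.TreeLengthTorusGeometry (period proj_add_period exists_period_of_proj_eq)
open Literature.MathematicalPhysics.QuantumLattice (blockMap blockSites mem_blockSites_iff)

/-! ## §1  The torus block is the projection of the integer block -/

section Torus

variable {d N : ℕ}

/-- Translating the centre translates the window block. [folklore] -/
theorem mem_block_add_iff (z w y : B13ScaleTransfer.Pt d) : y ∈ B13ScaleTransfer.block (z + w) ↔ y - w ∈ B13ScaleTransfer.block z := by
  simp only [B13ScaleTransfer.mem_block, Pi.add_apply, Pi.sub_apply]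
  exact forall_congr' fun i => by constructor <;> rintro ⟨h1, h2⟩ <;> constructor <;> linarith

/-- **`tblock (proj q̂) = (block q̂).image proj`** for every integer representative `q̂`. [cite: Balaban1987RG1, p.257 (definition of □̃)] -/
theorem tblock_proj [NeZero N] (z : B13ScaleTransfer.Pt d) : tblock (proj N z) = (B13ScaleTransfer.block z).image (proj N) := by
  obtain ⟨k, hk⟩ := exists_period_of_proj_eq (proj_natLift (proj N z)).symm
  unfold tblock
  rw [hk]
  ext c
  simp only [Finset.mem_image]
  constructor
  · rintro ⟨y, hy, rfl⟩
    exact ⟨y - period N k, (mem_block_add_iff z _ y).1 hy, by rw [show y = (y - period N k) + period N k from (sub_add_cancel y _).symm, proj_add_period, sub_add_cancel]⟩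
  · rintro ⟨y, hy, rfl⟩
    exact ⟨y + period N k, (mem_block_add_iff z _ _).2 (by rwa [add_sub_cancel_right]), proj_add_period y k⟩

/-- **`tcollar (S.image proj) = (collar S).image proj`.** [cite: Balaban1987RG1, p.257 (definition of X̃)] -/
theorem tcollar_image_proj [NeZero N] (S : Finset (B13ScaleTransfer.Pt d)) : tcollar (S.image (proj N)) = (B13ScaleTransfer.collar S).image (proj N) := by
  classical
  unfold tcollar B13ScaleTransfer.collar
  rw [Finset.image_biUnion, Finset.biUnion_image]
  exact Finset.biUnion_congr rfl fun z _ => tblock_proj z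

end Torus

section Record

variable {F : T4Family}

/-- ★ **`□̃_q = (g3cBlkZ q̂).image proj` for every representative `q̂` of the cube index `q`.** [cite: Balaban1987RG1, p.257; Balaban1985BackgroundPropagators, (3.87) p.409] -/
theorem g3cBlk_eq_image_proj (Mc k K : ℕ) (z : Fin 4 → ℤ) :
    ((g3cBlk F Mc k K (proj (Sect2.domCount (F.P K) Mc (k + 1)) z)).1 : Finset (TPt (F.P K).d (Sect2.domCount (F.P K) Mc (k + 1)))) =
      (g3cBlkZ z).image (proj (Sect2.domCount (F.P K) Mc (k + 1))) := by
  show tcollar (tblock (proj _ z)) = _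
  rw [tblock_proj, tcollar_image_proj]
  rfl

/-- `□̃_q = (g3cBlkZ (ι q)).image proj` for the centred representative. [cite: Balaban1987RG1, (1.21) p.264, p.257] -/
theorem g3cBlk_eq_image_proj_valMinAbs {Mc k K : ℕ} (q : TPt (F.P K).d (Sect2.domCount (F.P K) Mc (k + 1))) :
    ((g3cBlk F Mc k K q).1 : Finset (TPt (F.P K).d (Sect2.domCount (F.P K) Mc (k + 1)))) =
      (g3cBlkZ fun i => (q i).valMinAbs).image (proj (Sect2.domCount (F.P K) Mc (k + 1))) := by
  have h := g3cBlk_eq_image_proj (F := F) Mc k K (fun i => (q i).valMinAbs)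
  have e4 : (proj (Sect2.domCount (F.P K) Mc (k + 1)) (fun i : Fin 4 => (q i).valMinAbs) : TPt (F.P K).d (Sect2.domCount (F.P K) Mc (k + 1))) = q :=
    funext fun i => ZMod.coe_valMinAbs (q i)
  rwa [e4] at h

/-! ## §2  Off the wrap class the centred lift inverts the projection on every block inside `X` -/

/-- `Y ⊆ X` from `X̂_K(Y) ⊆ X̂_K(X)` (project). [cite: Balaban1987RG1, (1.21) p.264 (bookkeeping)] -/
theorem subset_of_intCubes_subset {Mc k K : ℕ} {X Y : (recordDomSys F Mc k K).Dom} (h : intCubes F Mc k K Y ⊆ intCubes F Mc k K X) :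
    (Y.1 : Finset (TPt (F.P K).d (Sect2.domCount (F.P K) Mc (k + 1)))) ⊆ X.1 := by
  intro c hc
  have h1 : (fun i => (c i).valMinAbs) ∈ intCubes F Mc k K X := h (Finset.mem_image_of_mem _ hc)
  obtain ⟨x, hx, hxc⟩ := Finset.mem_image.1 h1
  rwa [← valMinAbs_lift_injective _ hxc]

/-- A subset of `X̂_K(X)` projects into `X`, hence `□̃_q ⊆ X` whenever `g3cBlkZ (ι q) ⊆ X̂_K(X)`. [cite: Balaban1987RG1, (1.21) p.264, p.257] -/
theorem g3cBlk_subset_of_g3cBlkZ_subset {Mc k K : ℕ} {X : (recordDomSys F Mc k K).Dom} {q : TPt (F.P K).d (Sect2.domCount (F.P K) Mc (k + 1))}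
    (h : g3cBlkZ (fun i => (q i).valMinAbs) ⊆ intCubes F Mc k K X) :
    ((g3cBlk F Mc k K q).1 : Finset (TPt (F.P K).d (Sect2.domCount (F.P K) Mc (k + 1)))) ⊆ X.1 := by
  rw [g3cBlk_eq_image_proj_valMinAbs]
  exact image_proj_subset h

/-- Off the seam value, `valMinAbs` commutes with `−1` (companion of ✓`valMinAbs_add_one_of_ne_half`). [folklore] -/
theorem valMinAbs_intCast_sub_one {n : ℕ} [NeZero n] (s : ℤ) (h : (((s - 1 : ℤ) : ZMod n)).valMinAbs ≠ ((n / 2 : ℕ) : ℤ)) (hs : ((s : ℤ) : ZMod n).valMinAbs = s) :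
    (((s - 1 : ℤ) : ZMod n)).valMinAbs = s - 1 := by
  have h1 := valMinAbs_add_one_of_ne_half _ h
  rw [show (((s - 1 : ℤ) : ZMod n)) + 1 = ((s : ℤ) : ZMod n) by push_cast; ring, hs] at h1
  linarith

/-- Off the seam value, `valMinAbs` commutes with `+1` (integer-cast form of ✓`valMinAbs_add_one_of_ne_half`). [folklore] -/
theorem valMinAbs_intCast_add_one {n : ℕ} [NeZero n] (s : ℤ) (h : ((s : ℤ) : ZMod n).valMinAbs ≠ ((n / 2 : ℕ) : ℤ)) (hs : ((s : ℤ) : ZMod n).valMinAbs = s) :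
    (((s + 1 : ℤ) : ZMod n)).valMinAbs = s + 1 := by
  have h1 := valMinAbs_add_one_of_ne_half _ h
  rw [hs] at h1
  rw [← h1]; push_cast; rfl

/-- ★ **ON A BLOCK `□̃_q ⊆ X` OFF THE CENTRED WRAP CLASS, THE CENTRED LIFT INVERTS THE PROJECTION**: `ι (proj ŷ) = ŷ` for every `ŷ ∈ g3cBlkZ (ι q)` (no coordinate of the `5`-block meets the
antipodal seam, since every cube of `□̃_q` lies in the off-wrap `X`). [cite: Balaban1987RG1, (1.21) p.264, p.257] -/
theorem valMinAbs_proj_of_mem_g3cBlkZ {Mc k K : ℕ} {X : (recordDomSys F Mc k K).Dom} (hX : X ∉ recordWrapCtr F Mc k K)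
    {q : TPt (F.P K).d (Sect2.domCount (F.P K) Mc (k + 1))} (hq : ((g3cBlk F Mc k K q).1 : Finset (TPt (F.P K).d (Sect2.domCount (F.P K) Mc (k + 1)))) ⊆ X.1)
    {y : Fin 4 → ℤ} (hy : y ∈ g3cBlkZ fun i => (q i).valMinAbs) :
    (fun i : Fin 4 => ((proj (Sect2.domCount (F.P K) Mc (k + 1)) y : TPt (F.P K).d (Sect2.domCount (F.P K) Mc (k + 1))) i).valMinAbs) = y := by
  -- seam exclusion on the whole integer block, coordinatewise
  have hseam : ∀ u ∈ g3cBlkZ (fun i => (q i).valMinAbs), ∀ i : Fin 4,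
      (((u i : ℤ) : ZMod (Sect2.domCount (F.P K) Mc (k + 1)))).valMinAbs ≠ ((Sect2.domCount (F.P K) Mc (k + 1) / 2 : ℕ) : ℤ) := by
    intro u hu i
    have hin : (proj (Sect2.domCount (F.P K) Mc (k + 1)) u : TPt (F.P K).d (Sect2.domCount (F.P K) Mc (k + 1))) ∈ (X.1 : Finset _) := by
      refine hq ?_
      rw [g3cBlk_eq_image_proj_valMinAbs]
      exact Finset.mem_image_of_mem _ hu
    have hns := (not_onSeamCtr_iff _).1 (fun hs => hX ((mem_recordWrapCtr_iff F Mc k K X).2 ⟨_, hin, hs⟩))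
    exact hns i
  funext i
  change (((y i : ℤ) : ZMod (Sect2.domCount (F.P K) Mc (k + 1)))).valMinAbs = y i
  rw [mem_g3cBlkZ] at hy
  -- points of the block with the `i`-th coordinate moved to `t`, `|t − c| ≤ 2`, `c := ι q i`
  have hupd : ∀ t : ℤ, (q i).valMinAbs - 2 ≤ t → t ≤ (q i).valMinAbs + 2 →
      (((t : ℤ) : ZMod (Sect2.domCount (F.P K) Mc (k + 1)))).valMinAbs ≠ ((Sect2.domCount (F.P K) Mc (k + 1) / 2 : ℕ) : ℤ) := by
    intro t ht1 ht2
    have hu : Function.update y i t ∈ g3cBlkZ (fun j => (q j).valMinAbs) := by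
      rw [mem_g3cBlkZ]; intro j
      by_cases hji : j = i
      · subst hji; rw [Function.update_self]; exact ⟨ht1, ht2⟩
      · rw [Function.update_of_ne hji]; exact hy j
    have := hseam _ hu i
    rwa [Function.update_self] at this
  have h0 : (((q i).valMinAbs : ℤ) : ZMod (Sect2.domCount (F.P K) Mc (k + 1))).valMinAbs = (q i).valMinAbs := by rw [ZMod.coe_valMinAbs]
  have hp1 := valMinAbs_intCast_add_one _ (hupd _ (by linarith) (by linarith)) h0
  have hp2 := valMinAbs_intCast_add_one _ (hupd _ (by linarith) (by linarith)) hp1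
  have hm1 := valMinAbs_intCast_sub_one _ (hupd _ (by linarith) (by linarith)) h0
  have hm2 := valMinAbs_intCast_sub_one _ (hupd _ (by linarith) (by linarith)) hm1
  obtain ⟨hy1, hy2⟩ := hy i
  obtain ⟨δ, hδ⟩ : ∃ δ : ℤ, y i = (q i).valMinAbs + δ := ⟨y i - (q i).valMinAbs, by ring⟩
  have hδ1 : -2 ≤ δ := by linarith
  have hδ2 : δ ≤ 2 := by linarith
  rw [hδ]
  interval_cases δ
  · rw [show (q i).valMinAbs + -2 = (q i).valMinAbs - 1 - 1 by ring]; exact hm2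
  · rw [show (q i).valMinAbs + -1 = (q i).valMinAbs - 1 by ring]; exact hm1
  · rw [add_zero]; exact h0
  · exact hp1
  · rw [show (q i).valMinAbs + 2 = (q i).valMinAbs + 1 + 1 by ring]; exact hp2

/-- ★ **THE CENTRED LIFT OF `□̃_q ⊆ X` IS THE INTEGER BLOCK**: `X̂_K(□̃_q) = g3cBlkZ (ι q)` off the wrap class. [cite: Balaban1987RG1, (1.21) p.264, p.257; Balaban1985BackgroundPropagators, (3.87) p.409] -/
theorem intCubes_g3cBlk {Mc k K : ℕ} {X : (recordDomSys F Mc k K).Dom} (hX : X ∉ recordWrapCtr F Mc k K)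
    {q : TPt (F.P K).d (Sect2.domCount (F.P K) Mc (k + 1))} (hq : ((g3cBlk F Mc k K q).1 : Finset (TPt (F.P K).d (Sect2.domCount (F.P K) Mc (k + 1)))) ⊆ X.1) :
    intCubes F Mc k K (g3cBlk F Mc k K q) = g3cBlkZ fun i => (q i).valMinAbs := by
  rw [intCubes_eq_image, g3cBlk_eq_image_proj_valMinAbs]
  ext y
  constructor
  · intro hy
    obtain ⟨c, hc, rfl⟩ := Finset.mem_image.1 hy
    obtain ⟨y', hy', rfl⟩ := Finset.mem_image.1 hc
    exact (valMinAbs_proj_of_mem_g3cBlkZ hX hq hy').symm ▸ hy'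
  · intro hy
    exact Finset.mem_image.2 ⟨_, Finset.mem_image_of_mem _ hy, valMinAbs_proj_of_mem_g3cBlkZ hX hq hy⟩

/-! ## §3  The lifted walk and its localization -/

/-- **The centred lift of a walk**: `(□_i, Y_i) ↦ (ι □_i, X̂_K(Y_i))`. [cite: Balaban1987RG1, (1.21) p.264 (bookkeeping)] -/
def g3cLiftStep (F : T4Family) (Mc k K : ℕ) (s : TPt (F.P K).d (Sect2.domCount (F.P K) Mc (k + 1)) × (recordDomSys F Mc k K).Dom) : (Fin 4 → ℤ) × Finset (Fin 4 → ℤ) :=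
  (fun i => (s.1 i).valMinAbs, intCubes F Mc k K s.2)

/-- The lift of a step is injective. [cite: Balaban1987RG1, (1.21) p.264 (bookkeeping)] -/
theorem g3cLiftStep_injective (F : T4Family) (Mc k K : ℕ) : Function.Injective (g3cLiftStep F Mc k K) := by
  rintro ⟨q, Y⟩ ⟨q', Y'⟩ h
  simp only [g3cLiftStep, Prod.mk.injEq] at h
  obtain ⟨h1, h2⟩ := h
  exact Prod.ext (valMinAbs_lift_injective _ h1) (Subtype.ext (Finset.Subset.antisymm (subset_of_intCubes_subset h2.le) (subset_of_intCubes_subset h2.ge)))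

/-- The torus localization contains its parts. [cite: Balaban1987RG1, (1.7) p.261 (bookkeeping)] -/
theorem subset_of_g3cWalkLoc_eq {Mc k K : ℕ} {X : (recordDomSys F Mc k K).Dom} {q₀ : TPt (F.P K).d (Sect2.domCount (F.P K) Mc (k + 1))} {m : ℕ}
    {w : Fin m → TPt (F.P K).d (Sect2.domCount (F.P K) Mc (k + 1)) × (recordDomSys F Mc k K).Dom}
    (h : g3cWalkLoc F Mc k K q₀ w = X.1) :
    ((g3cBlk F Mc k K q₀).1 : Finset _) ⊆ X.1 ∧ ∀ i, ((w i).2.1 : Finset _) ⊆ X.1 ∧ ((g3cBlk F Mc k K (w i).1).1 : Finset _) ⊆ X.1 := by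
  rw [← h]; unfold g3cWalkLoc
  refine ⟨Finset.subset_union_left, fun i => ⟨?_, ?_⟩⟩
  · exact fun y hy => Finset.mem_union_right _ (Finset.mem_biUnion.2 ⟨i, Finset.mem_univ _, Finset.mem_union_left _ hy⟩)
  · exact fun y hy => Finset.mem_union_right _ (Finset.mem_biUnion.2 ⟨i, Finset.mem_univ _, Finset.mem_union_right _ hy⟩)

/-- **Under the block condition the lifted localization is the lift of the localization.** [cite: Balaban1987RG1, (1.21) p.264, (1.7) p.261] -/
theorem g3cWalkLocZ_lift_eq_image {Mc k K : ℕ} {X : (recordDomSys F Mc k K).Dom} (hX : X ∉ recordWrapCtr F Mc k K)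
    {q₀ : TPt (F.P K).d (Sect2.domCount (F.P K) Mc (k + 1))} {m : ℕ} {w : Fin m → TPt (F.P K).d (Sect2.domCount (F.P K) Mc (k + 1)) × (recordDomSys F Mc k K).Dom}
    (h0 : ((g3cBlk F Mc k K q₀).1 : Finset _) ⊆ X.1) (hs : ∀ i, ((g3cBlk F Mc k K (w i).1).1 : Finset _) ⊆ X.1) :
    g3cWalkLocZ (fun i => (q₀ i).valMinAbs) (fun i => g3cLiftStep F Mc k K (w i)) =
      (g3cWalkLoc F Mc k K q₀ w).image fun c i => (c i).valMinAbs := by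
  classical
  have key : g3cWalkLocZ (fun i => (q₀ i).valMinAbs) (fun i => g3cLiftStep F Mc k K (w i)) =
      (((g3cBlk F Mc k K q₀).1 : Finset (TPt (F.P K).d (Sect2.domCount (F.P K) Mc (k + 1)))) ∪
        Finset.univ.biUnion fun i : Fin m => ((w i).2.1 : Finset _) ∪ (g3cBlk F Mc k K (w i).1).1).image fun c i => (c i).valMinAbs := by
    rw [Finset.image_union, Finset.biUnion_image, ← intCubes_eq_image, intCubes_g3cBlk hX h0]
    unfold g3cWalkLocZ
    congr 1
    refine Finset.biUnion_congr rfl fun i _ => ?_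
    rw [Finset.image_union, ← intCubes_eq_image, ← intCubes_eq_image, intCubes_g3cBlk hX (hs i)]
    rfl
  unfold g3cWalkLoc
  convert key using 3

/-- ★ **THE LIFTED LOCALIZATION IS `X̂_K(X)` IFF THE LOCALIZATION IS `X`** (off the wrap class). [cite: Balaban1987RG1, (1.21) p.264, (1.7) p.261] -/
theorem g3cWalkLocZ_lift_iff {Mc k K : ℕ} {X : (recordDomSys F Mc k K).Dom} (hX : X ∉ recordWrapCtr F Mc k K)
    (q₀ : TPt (F.P K).d (Sect2.domCount (F.P K) Mc (k + 1))) {m : ℕ} (w : Fin m → TPt (F.P K).d (Sect2.domCount (F.P K) Mc (k + 1)) × (recordDomSys F Mc k K).Dom) :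
    g3cWalkLocZ (fun i => (q₀ i).valMinAbs) (fun i => g3cLiftStep F Mc k K (w i)) = intCubes F Mc k K X ↔ g3cWalkLoc F Mc k K q₀ w = X.1 := by
  constructor
  · intro h
    obtain ⟨h0, hs⟩ := subset_of_g3cWalkLocZ_eq h
    have hB0 := g3cBlk_subset_of_g3cBlkZ_subset h0
    have hBs : ∀ i, ((g3cBlk F Mc k K (w i).1).1 : Finset _) ⊆ X.1 := fun i => g3cBlk_subset_of_g3cBlkZ_subset (hs i).2
    rw [g3cWalkLocZ_lift_eq_image hX hB0 hBs, intCubes_eq_image] at h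
    exact Finset.image_injective (valMinAbs_lift_injective _) h
  · intro h
    obtain ⟨h0, hs⟩ := subset_of_g3cWalkLoc_eq h
    rw [g3cWalkLocZ_lift_eq_image hX h0 fun i => (hs i).2, h, intCubes_eq_image]

end Record

end Summit.QuantumFields.YangMills.Theorems.BalabanUVNodesPortS1

end
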